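import Summits.BirchSwinnertonDyer.Rank1Residual.ManinAdditive.UDCKummerLine
import Literature.NumberTheory.Automorphic.TypeIICharacterGroupNoncongruence
import HarnessLib

/-!
# The UDC line: the Kurth–Long input `TypeIINoncongruence` HOLDS (cell bsd-f2-manin, typer g20, T-an-43)

Companion of `UDCKummerLine.lean` (an g37, T-an-43 PART 1, p725103).  Of the two cite-shaped print inputs of the
UDC line, the group-theoretic one — Kurth–Long 2008 Prop. 18, typed by -an as `UDCKummerLine.TypeIINoncongruence`
(«a finite-index subgroup `Γ ≤ Γ₀(n)` normalised by `Γ₀(n)`, containing every trace-`±2` element of `Γ₀(n)`, not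
containing `Γ₁(n)`, contains no `Γ(M)`») — is a THEOREM of the tree: it is the Literature theorem
`Literature.NumberTheory.Automorphic.KurthLong2008_prop18_typeII_noncongruence` (typer g20,
`Literature/NumberTheory/Automorphic/TypeIICharacterGroupNoncongruence.lean`, proved from Wohlfahrt's theorem
`Wohlfahrt.Gamma_le_of_isCongruenceSubgroup_of_forall_conj_T_pow_mem` of `WohlfahrtTheorem.lean`), whose statement is
the body of the `def` verbatim.  Consequence for C3's v21 draft skeleton (an g37, Line-kato-shift-three-v21-draft):
the conjunct `TypeIINoncongruence` of the cite stub `stub_printInputsUDC` is discharged BY NAME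
(`UDCKummerLine.typeIINoncongruence_holds`); the other conjunct (`∀ k, UnboundedDenominatorsWeight k`, CDT 2025
Thm 1.0.1 in -an's meromorphic-at-the-cusps rendering) stays PRINT (the tree's vendored rendering
`Literature.NumberTheory.Automorphic.CalegariDimitrovTang2025_unboundedDenominators` is the holomorphic-at-the-cusps
case and does not imply it as stated).  Theorem-only; imports the landed leaf + the Literature theorem — route-independent.
PARTITION 0 · BSD is not proved by this; C3 OPEN.
-/

namespace Summit.BirchSwinnertonDyer.Rank1Residual.ManinAdditive.UDCKummerLine

/-- **`TypeIINoncongruence` holds** (Kurth–Long 2008 Prop. 18 = tree theorem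
`Literature.NumberTheory.Automorphic.KurthLong2008_prop18_typeII_noncongruence`, proved from Wohlfahrt's theorem). -/
theorem typeIINoncongruence_holds : TypeIINoncongruence :=
  fun n hn Γ hfi hle hnorm hII h1 M hM =>
    Literature.NumberTheory.Automorphic.KurthLong2008_prop18_typeII_noncongruence n hn Γ hfi hle hnorm hII h1 M hM

/-- Hence the restub conjunct is redundant: (AN♮)'s companion cite input reduces to the UDC theorem alone —
`(∀ k, UnboundedDenominatorsWeight k) ∧ TypeIINoncongruence ↔ (∀ k, UnboundedDenominatorsWeight k)`. -/
theorem printInputsUDC_iff :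
    ((∀ k : ℤ, UnboundedDenominatorsWeight k) ∧ TypeIINoncongruence) ↔ (∀ k : ℤ, UnboundedDenominatorsWeight k) :=
  ⟨fun h => h.1, fun h => ⟨h, typeIINoncongruence_holds⟩⟩

end Summit.BirchSwinnertonDyer.Rank1Residual.ManinAdditive.UDCKummerLine
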